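import Summits.BirchSwinnertonDyer.BirchSwinnertonDyer.Theorems.ManinLocalTwoThreeDiamondEisenstein
import Summits.BirchSwinnertonDyer.BirchSwinnertonDyer.Theorems.ManinLocalTwoThreeDeltaHomDiamond
import Summits.BirchSwinnertonDyer.BirchSwinnertonDyer.Theorems.ManinLocalTwoThreeEisensteinEnd
import HarnessLib

/-!
# The TAIL of the vertex step of MEMO-es §25 ((V-d)/(V-e), def-free): a `Δ_t(L')`-additive extension of a level-`M` class that
# kills the INTEGRAL unipotents kills ALL unipotents (class-function trick with `diag(t, t⁻¹)`), hence is diamond (E-es-34),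
# and a diamond generalised eigenclass with ONE prime `r` where `λ_r ≠ r + 1` vanishes (hNT end)

Summit `BirchSwinnertonDyer`, route `ManinLocalTwoThree` (cell bsd-f2-manin), crux C2 `ManinOddAtFour` (stmt-BirchSwinnertonDyer-22967),
registered stub `stub_cThreeImageResidual` (3 950 `C₃`-image classes) — the planner's line MEMO-es §25 (Bass–Serre / Wiles L.2.5
descent), vertex step E-es-41m assembled from {E-es-43 `DeltaCharacterExtension` (Φ on `Δ_t(L')` extending ũ₀), EXT-ODD/EXT-TWO (p2),
E-es-42 (p1), E-es-34 (p3 p599410), END}; also C3 stmt-BirchSwinnertonDyer-22968 through the shared machinery.  This file is the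
def-free end of that chain (§25.10 (c), (V-d), (V-e)):

* `deltaHom_upperUnip_eq_of_pow`, `deltaHom_lowerUnip_eq_of_pow` — for `Φ` additive on `Δ_t(L')`:
  `Φ(U⁺(x)) = Φ(U⁺(t^{2j} x))`, `Φ(U⁻(L' y)) = Φ(U⁻(L' t^{2j} y))` (conjugation by `diagP t ^ j ∈ Δ`, `Φ` is a class function);
* **`deltaHom_kills_unipotents_of_integral`** — if `Φ` kills the INTEGRAL unipotents `U⁺(m)` and `U⁻(L' t m)` (`m ∈ ℤ`; = the cusp
  values of the level-`tL'` class at `∞` and `0`), then `Φ` kills `U⁺(ℤ[1/t])` and `U⁻(L'ℤ[1/t])` — the hypotheses hU/hL of E-es-34;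
* **`exists_diamond_of_deltaHom_of_integral`** — hence `Φ ∘ ι` is a diamond function `η(d mod L')` on every `Γ₀(M)`, `L' ∣ M`;
* **`eq_zero_of_coe_eq_diamondFun_of_ne`** — hNT END: a cocycle whose cochain is `diamondFun M m K θ` (`m ∣ M`) and which lies in
  `maxGenEigenspace (T_r) (λ r)` for ONE prime `r ∤ M` with `λ r ≠ r + 1` is `0` (`T_r u = (r+1) u`, p3 E-es-33; eigenvalue pinning, p1).

Nothing about BSD or Manin's conjecture is proved here.  References: HOME/MEMO-es.md §25.10 (cell bsd-f2-manin).
-/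

set_option autoImplicit false
set_option linter.dupNamespace false

open scoped MatrixGroups

open CongruenceSubgroup Literature.NumberTheory.EllipticCurves.ModularForms
  Literature.NumberTheory.EllipticCurves.ModularForms.HidaCohomology
  Summit.BirchSwinnertonDyer.BirchSwinnertonDyer.Theorems.ConjSpanGenAllLevels
  Summit.BirchSwinnertonDyer.Rank1Residual.ManinAdditive

namespace Summit.BirchSwinnertonDyer.BirchSwinnertonDyer.Theorems.ManinLocalTwoThree

noncomputable section

/-! ### §1  Conjugation by `diag(t, t⁻¹)` scales unipotents by `t²` -/

section Conj

variable {t N : ℕ}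

/-- `diag(t,t⁻¹) ∈ Δ_t(N)` (upper triangular). [folklore] -/
theorem diagP_mem_Delta' : diagP t ∈ Delta t N := ⟨0, by simp [diagP]⟩

/-- `diag(t,t⁻¹) · U⁺(x) = U⁺(t² x) · diag(t,t⁻¹)`. [folklore] -/
theorem diagP_mul_upperUnip (x : Away t) :
    diagP t * upperUnip x = upperUnip ((t : Away t) ^ 2 * x) * diagP t := by
  have ht : (algebraMap ℤ (Away t) (t : ℤ)) = (t : Away t) := by simp
  have hinv : (t : Away t) * IsLocalization.Away.invSelf (t : ℤ) = 1 := by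
    rw [← ht]; exact IsLocalization.Away.mul_invSelf _
  ext i j
  fin_cases i <;> fin_cases j <;>
    simp [diagP, upperUnip, Matrix.mul_apply, Fin.sum_univ_two, ht]
  linear_combination (-(t : Away t) * x) * hinv

/-- `U⁻(y) · diag(t,t⁻¹) = diag(t,t⁻¹) · U⁻(t² y)`. [folklore] -/
theorem lowerUnip_mul_diagP (y : Away t) :
    lowerUnip y * diagP t = diagP t * lowerUnip ((t : Away t) ^ 2 * y) := by
  have ht : (algebraMap ℤ (Away t) (t : ℤ)) = (t : Away t) := by simp
  have hinv : (t : Away t) * IsLocalization.Away.invSelf (t : ℤ) = 1 := by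
    rw [← ht]; exact IsLocalization.Away.mul_invSelf _
  ext i j
  fin_cases i <;> fin_cases j <;>
    simp [diagP, lowerUnip, Matrix.mul_apply, Fin.sum_univ_two, ht]
  linear_combination (-(t : Away t) * y) * hinv

end Conj

/-! ### §2  A `Δ`-additive map is a class function under `diag(t,t⁻¹)`; integral unipotents suffice -/

section ClassFunction

variable {t N : ℕ} {K : Type*} [AddCommGroup K] (φ : SL(2, Away t) → K)
  (hadd : ∀ g ∈ Delta t N, ∀ g' ∈ Delta t N, φ (g * g') = φ g + φ g')

include hadd

/-- `φ(D g) = φ(g D)` for `g ∈ Δ`, `D = diag(t,t⁻¹)` (additivity + commutativity of `K`). [folklore] -/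
theorem deltaHom_diagP_mul_eq_mul_diagP {g : SL(2, Away t)} (hg : g ∈ Delta t N) :
    φ (diagP t * g) = φ (g * diagP t) := by
  rw [hadd _ diagP_mem_Delta' _ hg, hadd _ hg _ diagP_mem_Delta', add_comm]

/-- `φ(U⁺(x)) = φ(U⁺(t² x))`. [folklore] -/
theorem deltaHom_upperUnip_eq_sq (x : Away t) : φ (upperUnip x) = φ (upperUnip ((t : Away t) ^ 2 * x)) := by
  have h := deltaHom_diagP_mul_eq_mul_diagP φ hadd (upperUnip_mem_Delta (N := N) x)
  rw [diagP_mul_upperUnip] at h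
  -- `φ(U⁺(t²x) D) = φ(U⁺(x) D)`; cancel `φ(D)` by additivity
  rw [hadd _ (upperUnip_mem_Delta _) _ diagP_mem_Delta', hadd _ (upperUnip_mem_Delta _) _ diagP_mem_Delta'] at h
  exact (add_right_cancel h).symm

/-- `φ(U⁺(x)) = φ(U⁺(t^{2j} x))`. [folklore] -/
theorem deltaHom_upperUnip_eq_of_pow (x : Away t) (j : ℕ) : φ (upperUnip x) = φ (upperUnip ((t : Away t) ^ (2 * j) * x)) := by
  induction j generalizing x with
  | zero => simp
  | succ j ih => rw [ih x, deltaHom_upperUnip_eq_sq φ hadd, ← mul_assoc, ← pow_add]; ring_nf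

/-- `φ(U⁻(N y)) = φ(U⁻(N t² y))`. [folklore] -/
theorem deltaHom_lowerUnip_eq_sq (y : Away t) :
    φ (lowerUnip ((N : Away t) * y)) = φ (lowerUnip ((N : Away t) * ((t : Away t) ^ 2 * y))) := by
  have h := deltaHom_diagP_mul_eq_mul_diagP φ hadd (lowerUnip_mul_mem_Delta (N := N) ((t : Away t) ^ 2 * y))
  rw [← show lowerUnip ((N : Away t) * y) * diagP t = diagP t * lowerUnip ((N : Away t) * ((t : Away t) ^ 2 * y)) by
    rw [lowerUnip_mul_diagP]; ring_nf] at h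
  rw [hadd _ (lowerUnip_mul_mem_Delta _) _ diagP_mem_Delta', hadd _ (lowerUnip_mul_mem_Delta _) _ diagP_mem_Delta'] at h
  exact (add_right_cancel h)

/-- `φ(U⁻(N y)) = φ(U⁻(N t^{2j} y))`. [folklore] -/
theorem deltaHom_lowerUnip_eq_of_pow (y : Away t) (j : ℕ) :
    φ (lowerUnip ((N : Away t) * y)) = φ (lowerUnip ((N : Away t) * ((t : Away t) ^ (2 * j) * y))) := by
  induction j generalizing y with
  | zero => simp
  | succ j ih => rw [ih y, deltaHom_lowerUnip_eq_sq φ hadd, ← mul_assoc ((t : Away t) ^ 2), ← pow_add]; ring_nf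

/-- **Integral unipotents suffice.**  If a `Δ_t(N)`-additive `φ` kills the INTEGRAL unipotents `U⁺(m)` and `U⁻(N m)` (`m ∈ ℤ`),
it kills `U⁺(ℤ[1/t])` and `U⁻(N ℤ[1/t])` (every `x ∈ ℤ[1/t]` becomes integral after multiplication by `t^{2j}`, `j ≫ 0`).
These are the hypotheses hU/hL of E-es-34 `exists_diamond_of_deltaHom`. [folklore] -/
theorem deltaHom_kills_unipotents_of_integral (hU : ∀ m : ℤ, φ (upperUnip ((m : ℤ) : Away t)) = 0)
    (hL : ∀ m : ℤ, φ (lowerUnip ((N : Away t) * ((m : ℤ) : Away t))) = 0) :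
    (∀ x : Away t, φ (upperUnip x) = 0) ∧ (∀ y : Away t, φ (lowerUnip ((N : Away t) * y)) = 0) := by
  -- every `x` is `m / t^k`; then `t^{2k} x = m t^k` is integral
  have key : ∀ x : Away t, ∃ (j : ℕ) (m : ℤ), (t : Away t) ^ (2 * j) * x = ((m : ℤ) : Away t) := by
    intro x
    obtain ⟨⟨m, ⟨_, ⟨k, rfl⟩⟩⟩, hx⟩ := IsLocalization.surj (Submonoid.powers (t : ℤ)) x
    -- `hx : x * ↑(t^k) = ↑m`
    refine ⟨k, m * (t : ℤ) ^ k, ?_⟩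
    have hx' : x * ((t : Away t) ^ k) = ((m : ℤ) : Away t) := by simpa using hx
    rw [pow_mul, show ((t : Away t) ^ 2) ^ k = (t : Away t) ^ k * (t : Away t) ^ k by rw [← mul_pow]; ring_nf,
      mul_assoc, mul_comm ((t : Away t) ^ k) x, hx']
    push_cast
    ring
  refine ⟨fun x => ?_, fun y => ?_⟩
  · obtain ⟨j, m, hm⟩ := key x
    rw [deltaHom_upperUnip_eq_of_pow φ hadd x j, hm, hU]
  · obtain ⟨j, m, hm⟩ := key y
    rw [deltaHom_lowerUnip_eq_of_pow φ hadd y j, hm, hL]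

end ClassFunction

/-! ### §3  The diamond conclusion and the hNT end -/

section Tail

variable {t N : ℕ} {K : Type*} [CommRing K]

/-- **(V-d)+(V-e) of MEMO-es §25.10**: a `Δ_t(N)`-additive `φ` (`t ≥ 2`, `N ≥ 1`) killing the integral unipotents `U⁺(m)`, `U⁻(N m)`
is a DIAMOND character on every `ι Γ₀(M)`, `N ∣ M`: `φ(ι γ) = η(d_γ mod N)`, `η` additive on units (E-es-34, p3 p599410).
[folklore] -/
theorem exists_diamond_of_deltaHom_of_integral (ht : 2 ≤ t) [NeZero N] {M : ℕ} (hNM : N ∣ M) (φ : SL(2, Away t) → K)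
    (hadd : ∀ g ∈ Delta t N, ∀ g' ∈ Delta t N, φ (g * g') = φ g + φ g')
    (hU : ∀ m : ℤ, φ (upperUnip ((m : ℤ) : Away t)) = 0)
    (hL : ∀ m : ℤ, φ (lowerUnip ((N : Away t) * ((m : ℤ) : Away t))) = 0) :
    ∃ η : ZMod N → K, (∀ a b : ZMod N, IsUnit a → IsUnit b → η (a * b) = η a + η b) ∧
      ∀ γ : Gamma0 M, φ (iota t (γ : SL(2, ℤ))) = η ((((γ : SL(2, ℤ)) 1 1 : ℤ) : ZMod N)) := by
  obtain ⟨hU', hL'⟩ := deltaHom_kills_unipotents_of_integral φ hadd hU hL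
  exact exists_diamond_of_deltaHom_of_dvd φ hadd hU' hL' ht hNM

/-- **hNT END**: a cocycle whose cochain is a diamond function `diamondFun M m K θ` (`m ∣ M`, `θ` additive on units) and which
lies in the generalised `λ_r`-eigenspace of `T_r` for ONE prime `r ∤ M` with `λ_r ≠ r + 1` is `0` (E-es-33 `heckeU_diamondFun_eq_smul`:
`T_r u = (r+1) u`; an honest eigenvector in a generalised eigenspace pins the eigenvalue). [folklore] -/
theorem eq_zero_of_coe_eq_diamondFun_of_ne {F : Type*} [Field F] {M m : ℕ} (hmM : m ∣ M) (u : cocycles 0 M F)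
    (θ : ZMod m → F) (hθ : ∀ a b : ZMod m, IsUnit a → IsUnit b → θ (a * b) = θ a + θ b)
    (hdiam : (u : Gamma0 M → Fin 1 → F) = diamondFun M m F θ)
    {r : ℕ} [NeZero r] (hr : r.Prime) (hrM : ¬ r ∣ M) {μ : F} (hgen : u ∈ Module.End.maxGenEigenspace (heckeUZ 0 M F hr) μ)
    (hne : μ ≠ (r : F) + 1) : u = 0 := by
  by_contra h0
  have hT : heckeUZ 0 M F hr u = ((r : F) + 1) • u := by
    refine heckeUZ_eq_smul_of_coe hr u _ ?_
    rw [hdiam]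
    exact heckeU_diamondFun_eq_smul θ hmM hθ hr hrM
  exact hne (eq_of_apply_eq_smul_of_mem_maxGenEigenspace _ hT hgen h0)

end Tail



/-! ### §4  Appendix (v2): lower unipotents of level `tN` suffice (the cusp `0` of level `tL'`) -/

section TailT

variable {t N : ℕ} {K : Type*} [AddCommGroup K] (φ : SL(2, Away t) → K)
  (hadd : ∀ g ∈ Delta t N, ∀ g' ∈ Delta t N, φ (g * g') = φ g + φ g')

include hadd

/-- **Integral unipotents of level `tN` suffice** (MEMO-es §25.10 (c) exactly: «taking `2j ≥ k+1`»): if a `Δ_t(N)`-additive `φ`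
kills `U⁺(m)` and `U⁻(N·t·m)` for all integers `m` — the cusp values at `∞` and `0` of a class of level `tN` — then it kills
`U⁺(ℤ[1/t])` and `U⁻(N ℤ[1/t])`. [folklore] -/
theorem deltaHom_kills_unipotents_of_integral_mul (hU : ∀ m : ℤ, φ (upperUnip ((m : ℤ) : Away t)) = 0)
    (hL : ∀ m : ℤ, φ (lowerUnip ((N : Away t) * ((t : Away t) * ((m : ℤ) : Away t)))) = 0) :
    (∀ x : Away t, φ (upperUnip x) = 0) ∧ (∀ y : Away t, φ (lowerUnip ((N : Away t) * y)) = 0) := by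
  -- every `x` is `m / t^k`; then `t^{2(k+1)} x = t · (m t^{k+1})`
  have key : ∀ x : Away t, ∃ (j : ℕ) (m : ℤ), (t : Away t) ^ (2 * j) * x = (t : Away t) * ((m : ℤ) : Away t) := by
    intro x
    obtain ⟨⟨m, ⟨_, ⟨k, rfl⟩⟩⟩, hx⟩ := IsLocalization.surj (Submonoid.powers (t : ℤ)) x
    refine ⟨k + 1, m * (t : ℤ) ^ (k + 1), ?_⟩
    have hx' : x * ((t : Away t) ^ k) = ((m : ℤ) : Away t) := by simpa using hx
    have e : (t : Away t) ^ (2 * (k + 1)) * x = (t : Away t) ^ (k + 2) * (x * (t : Away t) ^ k) := by ring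
    rw [e, hx']
    push_cast
    ring
  refine ⟨fun x => ?_, fun y => ?_⟩
  · obtain ⟨j, m, hm⟩ := key x
    rw [deltaHom_upperUnip_eq_of_pow φ hadd x j, hm, show (t : Away t) * ((m : ℤ) : Away t) = (((t : ℤ) * m : ℤ) : Away t) by
      push_cast; ring, hU]
  · obtain ⟨j, m, hm⟩ := key y
    rw [deltaHom_lowerUnip_eq_of_pow φ hadd y j, hm, hL]

end TailT

/-- **(V-d)+(V-e), level-`tN` cusp values**: a `Δ_t(N)`-additive `φ` (`t ≥ 2`, `N ≥ 1`) killing `U⁺(m)` and `U⁻(N t m)`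
(`m ∈ ℤ`) is a diamond character `η(d mod N)` on every `ι Γ₀(M)`, `N ∣ M`. [folklore] -/
theorem exists_diamond_of_deltaHom_of_integral_mul {t N : ℕ} {K : Type*} [CommRing K] (ht : 2 ≤ t) [NeZero N] {M : ℕ}
    (hNM : N ∣ M) (φ : SL(2, Away t) → K)
    (hadd : ∀ g ∈ Delta t N, ∀ g' ∈ Delta t N, φ (g * g') = φ g + φ g')
    (hU : ∀ m : ℤ, φ (upperUnip ((m : ℤ) : Away t)) = 0)
    (hL : ∀ m : ℤ, φ (lowerUnip ((N : Away t) * ((t : Away t) * ((m : ℤ) : Away t)))) = 0) :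
    ∃ η : ZMod N → K, (∀ a b : ZMod N, IsUnit a → IsUnit b → η (a * b) = η a + η b) ∧
      ∀ γ : Gamma0 M, φ (iota t (γ : SL(2, ℤ))) = η ((((γ : SL(2, ℤ)) 1 1 : ℤ) : ZMod N)) := by
  obtain ⟨hU', hL'⟩ := deltaHom_kills_unipotents_of_integral_mul φ hadd hU hL
  exact exists_diamond_of_deltaHom_of_dvd φ hadd hU' hL' ht hNM

/-- **Cusp values from the level-`tN` class** (bridge to p2's parabolicity currency): if `φ ∘ ι` agrees on `Γ₀(M)` (`M = N·t`-type
level with `N t ∣ M`... here any `M` with the two unipotent families inside) with a cochain `u` up to a correction vanishing on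
unipotents, and `u` kills every cusp-fixing element, then `φ` kills `U⁺(m)` and `U⁻(N t m)`.  Stated minimally: the two
families `ι(T^m)` and `ι(U⁻(N t m))` lie in `Γ₀(N t)`, fix `∞` resp. `0`. [folklore] -/
theorem deltaHom_integral_unipotents_of_parabolic {t N : ℕ} {K : Type*} [AddCommGroup K] (φ : SL(2, Away t) → K)
    (u : Gamma0 (N * t) → Fin 1 → K)
    (hφu : ∀ γ : Gamma0 (N * t), ((γ : SL(2, ℤ)) 0 0 : ℤ) = 1 → ((γ : SL(2, ℤ)) 1 1 : ℤ) = 1 → φ (iota t (γ : SL(2, ℤ))) = u γ 0)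
    (hpar : ∀ γ : Gamma0 (N * t), ∀ c : OnePoint ℚ,
      Matrix.SpecialLinearGroup.mapGL ℚ (γ : SL(2, ℤ)) • c = c → u γ 0 = 0) :
    (∀ m : ℤ, φ (upperUnip ((m : ℤ) : Away t)) = 0) ∧
      (∀ m : ℤ, φ (lowerUnip ((N : Away t) * ((t : Away t) * ((m : ℤ) : Away t)))) = 0) := by
  constructor
  · intro m
    -- `U⁺(m) = ι(T^m)`, `T^m ∈ Γ₀(N t)` fixes `∞`
    let γ : Gamma0 (N * t) := ⟨ModularGroup.T ^ m, by rw [Gamma0_mem, ModularGroup.coe_T_zpow]; simp⟩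
    have e : ((γ : SL(2, ℤ)) : Matrix (Fin 2) (Fin 2) ℤ) = !![1, m; 0, 1] := ModularGroup.coe_T_zpow m
    have e00 : ((γ : SL(2, ℤ)) 0 0 : ℤ) = 1 := by
      show ((γ : SL(2, ℤ)) : Matrix (Fin 2) (Fin 2) ℤ) 0 0 = 1; rw [e]; rfl
    have e01 : ((γ : SL(2, ℤ)) 0 1 : ℤ) = m := by
      show ((γ : SL(2, ℤ)) : Matrix (Fin 2) (Fin 2) ℤ) 0 1 = m; rw [e]; rfl
    have e10 : ((γ : SL(2, ℤ)) 1 0 : ℤ) = 0 := by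
      show ((γ : SL(2, ℤ)) : Matrix (Fin 2) (Fin 2) ℤ) 1 0 = 0; rw [e]; rfl
    have e11 : ((γ : SL(2, ℤ)) 1 1 : ℤ) = 1 := by
      show ((γ : SL(2, ℤ)) : Matrix (Fin 2) (Fin 2) ℤ) 1 1 = 1; rw [e]; rfl
    have hι : iota t (γ : SL(2, ℤ)) = upperUnip ((m : ℤ) : Away t) := by
      ext i j
      rw [ConjSpanGenAllLevels.iota_apply]
      fin_cases i <;> fin_cases j <;> simp [upperUnip, e00, e01, e10, e11]
    rw [← hι, hφu γ e00 e11]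
    refine hpar γ OnePoint.infty ?_
    rw [OnePoint.smul_infty_eq_self_iff]
    show ((((γ : SL(2, ℤ)) 1 0 : ℤ) : ℚ)) = 0
    rw [e10, Int.cast_zero]
  · intro m
    -- `U⁻(N t m) = ι((1 0; N t m 1))`, which lies in `Γ₀(N t)` and fixes `0`
    let g : SL(2, ℤ) := ⟨!![1, 0; (N : ℤ) * t * m, 1], by rw [Matrix.det_fin_two_of]; ring⟩
    let γ : Gamma0 (N * t) := ⟨g, by
      rw [Gamma0_mem]
      show ((((N : ℤ) * t * m : ℤ)) : ZMod (N * t)) = 0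
      push_cast
      rw [show ((N : ZMod (N * t)) * (t : ZMod (N * t))) = ((N * t : ℕ) : ZMod (N * t)) by push_cast; ring, ZMod.natCast_self,
        zero_mul]⟩
    have hι : iota t (γ : SL(2, ℤ)) = lowerUnip ((N : Away t) * ((t : Away t) * ((m : ℤ) : Away t))) := by
      ext i j
      rw [ConjSpanGenAllLevels.iota_apply]
      fin_cases i <;> fin_cases j <;> simp [γ, g, lowerUnip]
      ring
    rw [← hι, hφu γ rfl rfl]
    refine hpar γ ((0 : ℚ) : OnePoint ℚ) ?_
    have m10 : ((Matrix.SpecialLinearGroup.mapGL ℚ (γ : SL(2, ℤ)) : GL (Fin 2) ℚ) : Matrix (Fin 2) (Fin 2) ℚ) 1 0 =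
        (((N : ℤ) * t * m : ℤ) : ℚ) := rfl
    have m11 : ((Matrix.SpecialLinearGroup.mapGL ℚ (γ : SL(2, ℤ)) : GL (Fin 2) ℚ) : Matrix (Fin 2) (Fin 2) ℚ) 1 1 = ((1 : ℤ) : ℚ) := rfl
    have m00 : ((Matrix.SpecialLinearGroup.mapGL ℚ (γ : SL(2, ℤ)) : GL (Fin 2) ℚ) : Matrix (Fin 2) (Fin 2) ℚ) 0 0 = ((1 : ℤ) : ℚ) := rfl
    have m01 : ((Matrix.SpecialLinearGroup.mapGL ℚ (γ : SL(2, ℤ)) : GL (Fin 2) ℚ) : Matrix (Fin 2) (Fin 2) ℚ) 0 1 = ((0 : ℤ) : ℚ) := rfl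
    rw [OnePoint.smul_some_eq_ite, m10, m11, m00, m01]
    simp

end

end Summit.BirchSwinnertonDyer.BirchSwinnertonDyer.Theorems.ManinLocalTwoThree
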